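import Mathlib
import HarnessLib
import Literature.Analysis.FluidPDE.SuitableWeak
import Literature.Analysis.FluidPDE.SelfSimilar
import Literature.Analysis.FluidPDE.LocalTypeI
import Summits.NavierStokesRegularity.NavierStokesRegularity.Theorems.RellichScarApexLocalisationSliceConstant
import Summits.NavierStokesRegularity.NavierStokesRegularity.Theorems.RellichScarApexLocalisationAnalyticSpread
import Summits.NavierStokesRegularity.NavierStokesRegularity.Theorems.RellichScarApexLocalisationBandQuantum
import Summits.NavierStokesRegularity.NavierStokesRegularity.Theorems.RellichScarApexLocalisationQuantumAccounting
import Summits.NavierStokesRegularity.NavierStokesRegularity.Theorems.RellichScarApexLocalisationQuantumCovariance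
import Summits.NavierStokesRegularity.NavierStokesRegularity.Theorems.RellichScarApexLocalisationPackingSum
import Summits.NavierStokesRegularity.NavierStokesRegularity.Theorems.RellichScarApexLocalisationQuantumAccountingSharp

/-!
# Line dissipation-quantum-tolerance (crux `RellichScar.ApexLocalisation`): reduction and corollaries

The line's known stubs are landed (`…SliceConstant`, `…AnalyticSpread`, `…BandQuantum`,
`…QuantumAccounting`, `…QuantumAccountingSharp`, `…QuantumCovariance`, `…TightIsApex`, `…PackingSum`;
`…TightIsApexKappa` in flight).  This file records, sorry-free:

* `tightProfileExistsV1_iff` — the v1 bet (∀e-form, threshold `9/4`) is the VACUOUS horn of the crux: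
  it holds iff no rate-Type-I singular slab profile exists (so skeleton v2 re-tunes the bet);
* `dissipationFloorSharp` — UNCONDITIONAL: every origin-singular continuous class-`(C,I)` profile pays
  `E(Q((0,0),R)) ≥ (2+2√2) e(C,I) > 0` at every scale `R`;
* `packingSum` — UNCONDITIONAL: the scale-summed packing bound `Σ_j 2^{-j} #S_j ≤ 2I/e(C,I)` for
  `R2^{-j}`-separated finite sets of final-slice singular points in `B̄_R(x₀)`.
-/

-- the summit and its single sub-problem share the name (CONVENTIONS §1), as in every Theorems file
set_option linter.dupNamespace false

namespace Summit.NavierStokesRegularity.NavierStokesRegularity.Theorems.RellichScarApexLocalisation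

open MeasureTheory Set Function Metric Filter Topology TopologicalSpace
open scoped ENNReal NNReal
open Literature.Analysis Literature.Analysis.FluidPDE

local notation "E³" => EuclideanSpace ℝ (Fin 3)

/-! ### The v1 bet is vacuous -/

/-- **The v1 bet is the vacuous horn of the crux**: the ∀e-form tolerance bet with threshold `9/4`
holds iff no rate-Type-I singular slab profile exists (for any rate constant).  (⇒: the quantum `e₀` of
the class `(C₁,4I₁)` makes `e₀/2` a quantum too; the bet's profile for `e₀/2` has `sup_r E < (9/8) e₀`,
contradicting the floor `E(Q((0,0),1)) ≥ 2e₀`; ⇐: trivial.) -/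
theorem tightProfileExistsV1_iff :
    (∀ C : ℝ, (∃ (u : ℝ → E³ → E³) (p : ℝ → E³ → ℝ) (G : ℝ → E³ → E³ →L[ℝ] E³),
        IsSuitableWeakSolutionOn (slab E³ (Iio 0) isOpen_Iio) 1 0 u p ∧
        HasWeakSpatialGradientOn (slab E³ (Iio 0) isOpen_Iio) u G ∧
        typeIBound (Set.Iio (0 : ℝ) ×ˢ Set.univ) u p G < ⊤ ∧ HasTypeITimeDecay C u ∧
        IsBackwardSingularPoint u 0) →
      ∃ (C₁ : ℝ) (I₁ : ℝ≥0∞), I₁ < ⊤ ∧ ∀ e : ℝ, 0 < e →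
        (∀ (v : ℝ → E³ → E³) (q : ℝ → E³ → ℝ) (H : ℝ → E³ → E³ →L[ℝ] E³),
          IsSuitableWeakSolutionOn (slab E³ (Iio 0) isOpen_Iio) 1 0 v q →
          HasWeakSpatialGradientOn (slab E³ (Iio 0) isOpen_Iio) v H →
          typeIBound (Iio (0 : ℝ) ×ˢ univ) v q H ≤ 4 * I₁ →
          HasTypeITimeDecay C₁ v →
          ContinuousOn (uncurry v) (Iio (0 : ℝ) ×ˢ univ) →
          IsBackwardSingularPoint v 0 →
          ENNReal.ofReal e ≤ ∫⁻ z in parabolicCylinder (1 / 2 : ℝ) ((-(1 / 4) : ℝ), (0 : E³)),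
            ENNReal.ofReal (frobeniusNormSq (H z.1 z.2))) →
        ∃ (u : ℝ → E³ → E³) (p : ℝ → E³ → ℝ) (G : ℝ → E³ → E³ →L[ℝ] E³),
          IsSuitableWeakSolutionOn (slab E³ (Iio 0) isOpen_Iio) 1 0 u p ∧
          HasWeakSpatialGradientOn (slab E³ (Iio 0) isOpen_Iio) u G ∧
          typeIBound (Iio (0 : ℝ) ×ˢ univ) u p G ≤ I₁ ∧
          HasTypeITimeDecay C₁ u ∧
          ContinuousOn (uncurry u) (Iio (0 : ℝ) ×ˢ univ) ∧
          IsBackwardSingularPoint u 0 ∧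
          (⨆ (r : ℝ) (_ : 0 < r), cknE r ((0 : ℝ), (0 : E³)) G) < ENNReal.ofReal (9 / 4 * e)) ↔
    (∀ C : ℝ, ¬ ∃ (u : ℝ → E³ → E³) (p : ℝ → E³ → ℝ) (G : ℝ → E³ → E³ →L[ℝ] E³),
        IsSuitableWeakSolutionOn (slab E³ (Iio 0) isOpen_Iio) 1 0 u p ∧
        HasWeakSpatialGradientOn (slab E³ (Iio 0) isOpen_Iio) u G ∧
        typeIBound (Set.Iio (0 : ℝ) ×ˢ Set.univ) u p G < ⊤ ∧ HasTypeITimeDecay C u ∧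
        IsBackwardSingularPoint u 0) := by
  refine ⟨fun hbet C hant => ?_, fun h C hant => absurd hant (h C)⟩
  obtain ⟨C₁, I₁, hI₁, hb⟩ := hbet C hant
  -- the quantum of the class `(C₁, 4 I₁)` and its half
  have h4I₁ : 4 * I₁ < ⊤ := ENNReal.mul_lt_top (by simp) hI₁
  obtain ⟨e₀, he₀, hq₀⟩ := stub_bandQuantumPos stub_sliceConstant stub_analyticSpread C₁ (4 * I₁) h4I₁
  have hqhalf : ∀ (v : ℝ → E³ → E³) (q : ℝ → E³ → ℝ) (H : ℝ → E³ → E³ →L[ℝ] E³),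
      IsSuitableWeakSolutionOn (slab E³ (Iio 0) isOpen_Iio) 1 0 v q →
      HasWeakSpatialGradientOn (slab E³ (Iio 0) isOpen_Iio) v H →
      typeIBound (Iio (0 : ℝ) ×ˢ univ) v q H ≤ 4 * I₁ →
      HasTypeITimeDecay C₁ v →
      ContinuousOn (uncurry v) (Iio (0 : ℝ) ×ˢ univ) →
      IsBackwardSingularPoint v 0 →
      ENNReal.ofReal (e₀ / 2) ≤ ∫⁻ z in parabolicCylinder (1 / 2 : ℝ) ((-(1 / 4) : ℝ), (0 : E³)),
        ENNReal.ofReal (frobeniusNormSq (H z.1 z.2)) :=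
    fun v q H hv hvg hvI hvC hvcont hvsing =>
      (ENNReal.ofReal_le_ofReal (by linarith)).trans (hq₀ v q H hv hvg hvI hvC hvcont hvsing)
  -- the bet's profile for the quantum `e₀/2`
  obtain ⟨u, p, G, hsw, hwg, hIle, hC, hcont, hsing, htight⟩ := hb (e₀ / 2) (by positivity) hqhalf
  -- the floor `2 e₀ ≤ E(Q((0,0),1)) ≤ sup_r E`
  have hIle4 : typeIBound (Iio (0 : ℝ) ×ˢ univ) u p G ≤ 4 * I₁ :=
    hIle.trans (by
      calc I₁ = 1 * I₁ := (one_mul _).symm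
        _ ≤ 4 * I₁ := by gcongr; norm_num)
  have hgen := stub_quantumCovariance C₁ (4 * I₁) e₀ he₀.le hq₀ u p G hsw hwg hIle4 hC hcont 0 hsing
  have hfloor : ENNReal.ofReal (2 * e₀) ≤ cknE 1 ((0 : ℝ), (0 : E³)) G :=
    stub_quantumAccounting.1 G e₀ he₀.le hgen 1 one_pos
  have hsup : cknE 1 ((0 : ℝ), (0 : E³)) G ≤ ⨆ (r : ℝ) (_ : 0 < r), cknE r ((0 : ℝ), (0 : E³)) G :=
    le_iSup₂ (f := fun (r : ℝ) (_ : 0 < r) => cknE r ((0 : ℝ), (0 : E³)) G) 1 one_pos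
  have hlt : ENNReal.ofReal (2 * e₀) < ENNReal.ofReal (9 / 4 * (e₀ / 2)) :=
    lt_of_le_of_lt (hfloor.trans hsup) htight
  rw [ENNReal.ofReal_lt_ofReal_iff (by positivity)] at hlt
  linarith


/-! ### Unconditional corollaries -/

/-- **DISSIPATION FLOOR, sharp** (unconditional by-product of the line, S3 + S5 + S4'(a)): for every class
`(C, I)`, `I < ⊤`, there is `e > 0` such that every continuous class profile singular at the origin has
origin-anchored scaled dissipation `E(Q((0,0),R)) = R⁻¹ ∫∫_{Q_R} |∇u|² ≥ (2+2√2) e` at EVERY scale `R > 0`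
(CKN's ε-regularity only gives `limsup_{R→0} E ≥ ε`). -/
theorem dissipationFloorSharp :
    ∀ (C : ℝ) (I : ℝ≥0∞), I < ⊤ → ∃ e : ℝ, 0 < e ∧
      ∀ (u : ℝ → E³ → E³) (p : ℝ → E³ → ℝ) (G : ℝ → E³ → E³ →L[ℝ] E³),
        IsSuitableWeakSolutionOn (slab E³ (Iio 0) isOpen_Iio) 1 0 u p →
        HasWeakSpatialGradientOn (slab E³ (Iio 0) isOpen_Iio) u G →
        typeIBound (Iio (0 : ℝ) ×ˢ univ) u p G ≤ I →
        HasTypeITimeDecay C u →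
        ContinuousOn (uncurry u) (Iio (0 : ℝ) ×ˢ univ) →
        IsBackwardSingularPoint u 0 →
        ∀ R : ℝ, 0 < R → ENNReal.ofReal ((2 + 2 * Real.sqrt 2) * e) ≤ cknE R ((0 : ℝ), (0 : E³)) G := by
  intro C I hI
  obtain ⟨e, he, hq⟩ := stub_bandQuantumPos stub_sliceConstant stub_analyticSpread C I hI
  refine ⟨e, he, fun u p G hsw hwg hIle hC hcont hsing R hR => ?_⟩
  have hgen := stub_quantumCovariance C I e he.le hq u p G hsw hwg hIle hC hcont 0 hsing
  exact stub_quantumAccountingSharp.1 G e he.le hgen R hR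

/-- **PACKING SUM BOUND for the final-time singular set** (unconditional corollary, S3 + S5 +
`stub_packingSum`): for every class `(C, I)`, `I < ⊤`, there is `e > 0` such that for every
continuous class profile, every `x₀`, `R > 0` and every sequence of `R 2^{-j}`-separated finite sets
`S_j` of final-slice singular points in `B̄_R(x₀)`, `Σ_j 2^{-j} #S_j ≤ 2I/e` — uniformly over the class,
its translates, zooms and limits. (CKN give only `ℋ¹(Σ) = 0`; a set with `#S_j ≍ 2^j/j` is
`ℋ¹`-null but violates the bound.) -/
theorem packingSum :
    ∀ (C : ℝ) (I : ℝ≥0∞), I < ⊤ → ∃ e : ℝ, 0 < e ∧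
      ∀ (u : ℝ → E³ → E³) (p : ℝ → E³ → ℝ) (G : ℝ → E³ → E³ →L[ℝ] E³),
        IsSuitableWeakSolutionOn (slab E³ (Iio 0) isOpen_Iio) 1 0 u p →
        HasWeakSpatialGradientOn (slab E³ (Iio 0) isOpen_Iio) u G →
        typeIBound (Iio (0 : ℝ) ×ˢ univ) u p G ≤ I →
        HasTypeITimeDecay C u →
        ContinuousOn (uncurry u) (Iio (0 : ℝ) ×ˢ univ) →
        ∀ (x₀ : E³) (R : ℝ), 0 < R → ∀ S : ℕ → Finset E³,
          (∀ j : ℕ, ∀ b ∈ S j, IsBackwardSingularPoint u ((0 : ℝ), b) ∧ dist b x₀ ≤ R) →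
          (∀ j : ℕ, (↑(S j) : Set E³).Pairwise fun b b' => R * 2⁻¹ ^ j ≤ dist b b') →
          ∑' j : ℕ, (2⁻¹ : ℝ≥0∞) ^ j * ((S j).card : ℝ≥0∞) ≤ 2 * I / ENNReal.ofReal e := by
  intro C I hI
  obtain ⟨e, he, hq⟩ := stub_bandQuantumPos stub_sliceConstant stub_analyticSpread C I hI
  exact ⟨e, he, stub_packingSum C I e he (stub_quantumCovariance C I e he.le hq)⟩

end Summit.NavierStokesRegularity.NavierStokesRegularity.Theorems.RellichScarApexLocalisation
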